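import Mathlib
import Literature.Computability.AlgebraicComplexity.ApolarityAction
import Literature.Computability.AlgebraicComplexity.LinSubst
import Literature.Computability.Complexity.OccurrenceObstructionsBIP
import Summits.ValiantsHypothesis.ValiantsHypothesis.Theorems.ValuativeGCTValuativeFlipCatalecticantPaddingCols
import Summits.ValiantsHypothesis.ValiantsHypothesis.Theorems.ValuativeGCTValuativeFlipCatalecticantShifted
import Summits.ValiantsHypothesis.ValiantsHypothesis.Theorems.ValuativeGCTValuativeFlipCatalecticantShapes

/-!
# The shifted-partials criterion, column form (transpose symmetry)

Crux `ValuativeGCT.ValuativeFlip` (stmt-ValiantsHypothesis-12624), wall-breaker axis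
"explicit padded-permanent highest-weight vectors for seedRichness" (k5 gen 1, seat 3), part 5.

The row criterion of part 4 (`det_catMinorMat_eq_zero_of_card_lt`: row degree `p + t`,
`#UpIdx (b-1) i₂ + #UpIdx t i₁ < #UpIdx b i₂ ⇒ det Cat(ℓ^p G)_corner = 0`) transposed through the
factorial symmetry of part 3 (`det_catMinorMat_mul_prod_eq`): for COLUMN degree `p + t'` and row degree
`a`, `#UpIdx (a-1) i₁ + #UpIdx t' i₂ < #UpIdx a i₁ ⇒ det = 0` (characteristic zero), and the
padded-permanent instance.  Row and column forms together reproduce the small-case census of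
`Cruxes/ValuativeFlip/AxisK5G1S3CatalecticantShapes.md` exactly.  [Iarrobino–Kanev LNM 1721 §1.1; folklore]
-/

set_option linter.dupNamespace false

namespace Summit.ValiantsHypothesis.ValiantsHypothesis.Theorems.ValuativeFlip

open MvPolynomial
open scoped BigOperators Matrix
open Literature.Computability.AlgebraicComplexity
open Literature.Computability.Complexity
open Literature.NumberTheory.DiophantineGeometry

noncomputable section

section Criterion

variable {σ : Type*} [Fintype σ] [LinearOrder σ] {k : Type*} [Field k]

/-- **Column form of the criterion** (transpose symmetry, characteristic zero): for column degree
`p + t'` and row degree `a`, if `#UpIdx σ (a-1) i₁ + #UpIdx σ t' i₂ < #UpIdx σ a i₁` then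
`det Cat(ℓ^p G)_{a, p+t'; i₁, i₂} = 0`. [folklore] -/
theorem det_catMinorMat_eq_zero_of_card_lt_cols [CharZero k] {ℓ G : MvPolynomial σ k} (hℓ : ℓ.IsHomogeneous 1)
    (c : σ → k) (hc : ∀ i, pderiv i ℓ = C (c i)) (p t' a : ℕ) (i₁ i₂ : σ)
    (e : UpIdx σ a i₁ ≃ UpIdx σ (p + t') i₂)
    (hlt : Fintype.card (UpIdx σ (a - 1) i₁) + Fintype.card (UpIdx σ t' i₂) < Fintype.card (UpIdx σ a i₁)) :
    (catMinorMat a (p + t') i₁ i₂ e (ℓ ^ p * G)).det = 0 := by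
  classical
  have key := det_catMinorMat_mul_prod_eq a (p + t') i₁ i₂ e (ℓ ^ p * G)
  rw [det_catMinorMat_eq_zero_of_card_lt hℓ c hc p t' a i₂ i₁ e.symm hlt, mul_zero] at key
  have hne : (∏ r' : UpIdx σ a i₁, ∏ i ∈ (e r').vec.support, (((e r').vec i).factorial : k)) ≠ 0 :=
    Finset.prod_ne_zero_iff.mpr fun r' _ => Finset.prod_ne_zero_iff.mpr fun i _ => by
      exact_mod_cast Nat.factorial_ne_zero _
  exact (mul_eq_zero.mp key).resolve_right hne

end Criterion

section Padded

/-- **Column form for the padded permanent**: column degree `m - n + t'`, row degree `a`,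
`#UpIdx (a-1) i₁ + #UpIdx t' i₂ < #UpIdx a i₁` ⇒ the corner minor vanishes at every `A · pp`.
[this crux (AxisK5G1S3); folklore] -/
theorem det_catMinorMat_paddedPer_eq_zero_of_card_lt_cols (n m t' a : ℕ) [NeZero m] (i₁ i₂ : MatIdx m)
    (e : UpIdx (MatIdx m) a i₁ ≃ UpIdx (MatIdx m) (m - n + t') i₂) (A : Matrix (MatIdx m) (MatIdx m) ℂ)
    (hlt : Fintype.card (UpIdx (MatIdx m) (a - 1) i₁) + Fintype.card (UpIdx (MatIdx m) t' i₂) <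
      Fintype.card (UpIdx (MatIdx m) a i₁)) :
    (catMinorMat a (m - n + t') i₁ i₂ e (linSubst (MatIdx m) ℂ A (paddedPerFormLex ℂ n m))).det = 0 := by
  rw [paddedPerFormLex_eq, map_mul, map_pow]
  refine det_catMinorMat_eq_zero_of_card_lt_cols ?_ (fun i => A i (toLex ((0 : Fin m), (0 : Fin m))))
    (fun i => pderiv_linSubst_X A _ i) (m - n) t' a i₁ i₂ e hlt
  rw [linSubst_X]
  exact IsHomogeneous.sum _ _ _ fun l _ => by
    rw [smul_eq_C_mul]; exact (isHomogeneous_X ℂ l).C_mul _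


/-- **All landed constraints on a live corner, in one statement.**  If a corner minor of the
catalecticant (rows degree `a` on the segment of `i₁`, columns degree `b` on the segment of `i₂`,
`a + b = m`, both segments of at least two variables) is nonzero at ONE point `A · (X₀₀^{m-n} per_n)`,
then: (i) `min(a,b) ≥ m - n` (padding vanishing, parts 2–3); (ii) `min(N₁,N₂) · (m-n) ≤ m`
(Kadish–Landsberg filter, part 1); (iii) the row and (iv) the column shifted-partials counts are not
violated (parts 4–5): `#UpIdx b i₂ ≤ #UpIdx (b-1) i₂ + #UpIdx (a-(m-n)) i₁` and
`#UpIdx a i₁ ≤ #UpIdx (a-1) i₁ + #UpIdx (b-(m-n)) i₂`.  In the sample tail cells of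
`Cruxes/ValuativeFlip/AxisK5G1S3CatalecticantShapes.md` these four conditions leave only the principal
corners `a = b = m/2`, `N₁ = N₂ ≤ m/(m-n) ≤ 5`. [this crux (AxisK5G1S3); folklore] -/
theorem catMinor_paddedPer_alive_conditions (n m a b : ℕ) [NeZero m] (hnm : n ≤ m) (hab : a + b = m)
    (i₁ i₂ : MatIdx m) (h1 : 2 ≤ Fintype.card {l : MatIdx m // i₁ ≤ l})
    (h2 : 2 ≤ Fintype.card {l : MatIdx m // i₂ ≤ l})
    (e : UpIdx (MatIdx m) a i₁ ≃ UpIdx (MatIdx m) b i₂) (A : Matrix (MatIdx m) (MatIdx m) ℂ)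
    (hA : (catMinorMat a b i₁ i₂ e (linSubst (MatIdx m) ℂ A (paddedPerFormLex ℂ n m))).det ≠ 0) :
    (m - n ≤ a ∧ m - n ≤ b) ∧
    min (Fintype.card {l : MatIdx m // i₁ ≤ l}) (Fintype.card {l : MatIdx m // i₂ ≤ l}) * (m - n) ≤ m ∧
    Fintype.card (UpIdx (MatIdx m) b i₂) ≤
      Fintype.card (UpIdx (MatIdx m) (b - 1) i₂) + Fintype.card (UpIdx (MatIdx m) (a - (m - n)) i₁) ∧
    Fintype.card (UpIdx (MatIdx m) a i₁) ≤
      Fintype.card (UpIdx (MatIdx m) (a - 1) i₁) + Fintype.card (UpIdx (MatIdx m) (b - (m - n)) i₂) := by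
  have hsurv := sub_le_and_sub_le_of_det_catMinorMat_paddedPer_ne_zero n m a b i₁ i₂ h1 h2 e A hA
  refine ⟨hsurv, ?_, ?_, ?_⟩
  · subst hab
    exact min_card_mul_sub_le_of_catMinor_ne_zero n a b hnm i₁ i₂ e A hA
  · obtain ⟨t, rfl⟩ : ∃ t, a = m - n + t := ⟨a - (m - n), by omega⟩
    rw [Nat.add_sub_cancel_left]
    exact not_lt.mp fun hlt => hA (det_catMinorMat_paddedPer_eq_zero_of_card_lt n m t b i₁ i₂ e A hlt)
  · obtain ⟨t', rfl⟩ : ∃ t', b = m - n + t' := ⟨b - (m - n), by omega⟩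
    rw [Nat.add_sub_cancel_left]
    exact not_lt.mp fun hlt => hA (det_catMinorMat_paddedPer_eq_zero_of_card_lt_cols n m t' a i₁ i₂ e A hlt)

/-- **Registered form** (stub `catMinor_paddedPer_shifted_cols` of stmt-ValiantsHypothesis-12624, one-line
`∀` signature). [this crux; folklore] -/
theorem catMinor_paddedPer_shifted_cols :
    ∀ (n m t' a : ℕ) [NeZero m] (i₁ i₂ : MatIdx m) (e : UpIdx (MatIdx m) a i₁ ≃ UpIdx (MatIdx m) (m - n + t') i₂) (A : Matrix (MatIdx m) (MatIdx m) ℂ), Fintype.card (UpIdx (MatIdx m) (a - 1) i₁) + Fintype.card (UpIdx (MatIdx m) t' i₂) < Fintype.card (UpIdx (MatIdx m) a i₁) → (catMinorMat a (m - n + t') i₁ i₂ e (linSubst (MatIdx m) ℂ A (paddedPerFormLex ℂ n m))).det = 0 :=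
  fun n m t' a _ i₁ i₂ e A hlt => det_catMinorMat_paddedPer_eq_zero_of_card_lt_cols n m t' a i₁ i₂ e A hlt

end Padded

end

end Summit.ValiantsHypothesis.ValiantsHypothesis.Theorems.ValuativeFlip
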